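import Summits.AnomalousDissipation.AnomalousDissipation.Theorems.SawtoothPulseCascadeK1LocalisedCascadeLatticeRays

/-!
# K1loc explicit start — helper: ENERGY OF AN `N`-TOOTH CHIRP AWAY FROM ITS LOBES («NToothOffLobe», dischargers j_V / j_O)

Helper file of the prover lane on the crux `K1LocalisedCascade` (stmt-AnomalousDissipation-19491), route `SawtoothPulseCascade`
(arbiter A24-5 R1).  For the exact `N`-tooth chirp `g₀(t) = exp(−2πiλ·tri(2πNt)/(2πN))` with `λ = N·L` (lobes at `m = ±λ`):
* §1 `‖g₀‖ = 1`, Parseval `Σ'‖ĝ₀‖² = 1`;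
* §2 pointwise: outside the lobes (`|m| > |λ|`) `‖ĝ₀(m)‖ ≤ [N∣m]·N/(π(|m|−|λ|))`, inside (`|m| < |λ|`) `‖ĝ₀(m)‖ ≤ [N∣m]·2N|λ|/(π(λ²−m²))`;
* §3 (series bookkeeping in `LatticeRays`);
* §4 **`tsum_outside_sq_norm_nTooth_le`**: `Σ'_{|m| ≥ |λ|+NE} ‖ĝ₀(m)‖² ≤ 2/(π²(E−1))`, **`sum_inside_sq_norm_nTooth_le`**:
  `Σ_{|m| ≤ |λ|−D, N∣m} ‖ĝ₀(m)‖² ≤ (2(|L|−E)+1)·(2N|λ|/(πD(2|λ|−D)))²` (`D = NE ≤ |λ|`);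
Pure chirp facts; no definitions; nothing about the crux. [cite: Grafakos2014, Prop. 3.1.2 (5), Prop. 3.2.7 (3)] [problem: turb]
-/

-- `Summit.<Summit>.<Problem>`: single-conjunct summit, the duplicate namespace segment is deliberate.
set_option linter.dupNamespace false

noncomputable section

namespace Summit.AnomalousDissipation.AnomalousDissipation.Theorems.SawtoothPulseCascade.K1Window

open MeasureTheory Filter Topology UnitAddTorus Complex AddCircle
open scoped Real
open Literature.Analysis Literature.Analysis.FunctionSpaces Literature.Analysis.FunctionSpaces.Torus Literature.Analysis.FluidPDE
open Literature.Analysis.FluidPDE.ShearStage Literature.Analysis.FluidPDE.SawtoothCascade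
open Summit.AnomalousDissipation.AnomalousDissipation.Theorems.SawtoothPulseCascade.K1Start

/-! ## §1 Modulus one and Parseval -/

/-- The exact `N`-tooth chirp has modulus one. [folklore] -/
theorem norm_nToothChirp_eq_one {N : ℕ} {lam : ℤ} {g₀ : UnitAddCircle → ℂ}
    (hg₀ : ∀ t : ℝ, g₀ (t : UnitAddCircle) = Complex.exp (-(2 * π * I * lam * ((tri (2 * π * N * t) / (2 * π * N) : ℝ) : ℂ))))
    (x : UnitAddCircle) : ‖g₀ x‖ = 1 := by
  obtain ⟨t, rfl⟩ := QuotientAddGroup.mk_surjective x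
  rw [show (QuotientAddGroup.mk t : UnitAddCircle) = ((t : ℝ) : UnitAddCircle) from rfl, hg₀ t,
    show (-(2 * π * I * lam * ((tri (2 * π * N * t) / (2 * π * N) : ℝ) : ℂ)) : ℂ) =
      ((-(2 * π * lam * (tri (2 * π * N * t) / (2 * π * N))) : ℝ) : ℂ) * I by push_cast; ring, Complex.norm_exp_ofReal_mul_I]

/-- **Parseval for the exact `N`-tooth chirp**: `Σ'_m ‖ĝ₀(m)‖² = 1`. [cite: Grafakos2014, Prop. 3.2.7 (3)] -/
theorem hasSum_sq_norm_fourierCoeff_nTooth {N : ℕ} {lam : ℤ} {g₀ : UnitAddCircle → ℂ}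
    (hg₀ : ∀ t : ℝ, g₀ (t : UnitAddCircle) = Complex.exp (-(2 * π * I * lam * ((tri (2 * π * N * t) / (2 * π * N) : ℝ) : ℂ))))
    (hg₀c : Continuous g₀) : HasSum (fun m : ℤ => ‖fourierCoeff g₀ m‖ ^ 2) 1 := by
  have hmem : MemLp g₀ 2 haarAddCircle :=
    (memLp_top_of_bound hg₀c.aestronglyMeasurable 1 (Eventually.of_forall fun b => (norm_nToothChirp_eq_one hg₀ b).le)).mono_exponent
      le_top
  have h := hasSum_sq_fourierCoeff (hmem.toLp _)
  have hcoe : ∀ p, fourierCoeff (hmem.toLp _) p = fourierCoeff g₀ p := by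
    intro p
    simp only [fourierCoeff]
    exact integral_congr_ae (by filter_upwards [MemLp.coeFn_toLp hmem] with x hx; simp only [hx])
  have hint : ∫ t, ‖(hmem.toLp _) t‖ ^ 2 ∂haarAddCircle = 1 := by
    have h1 : ∫ t, ‖(hmem.toLp _) t‖ ^ 2 ∂haarAddCircle = ∫ t, ‖g₀ t‖ ^ 2 ∂haarAddCircle :=
      integral_congr_ae (by filter_upwards [MemLp.coeFn_toLp hmem] with t ht; rw [ht])
    rw [h1]
    simp [norm_nToothChirp_eq_one hg₀]
  simp_rw [hcoe] at h
  rwa [hint] at h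

/-! ## §2 Pointwise bounds away from the lobes -/

/-- **Outside the lobes**: for `|m| > |λ|`, `‖ĝ₀(m)‖ ≤ [N∣m]·N/(π(|m|−|λ|))`. [cite: Grafakos2014, Prop. 3.1.2 (5)] -/
theorem norm_fourierCoeff_nTooth_le_outside {N : ℕ} (hN : 0 < N) (lam : ℤ) {g₀ : UnitAddCircle → ℂ}
    (hg₀ : ∀ t : ℝ, g₀ (t : UnitAddCircle) = Complex.exp (-(2 * π * I * lam * ((tri (2 * π * N * t) / (2 * π * N) : ℝ) : ℂ))))
    {m : ℤ} (hm : |lam| < |m|) :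
    ‖fourierCoeff g₀ m‖ ≤ if (N : ℤ) ∣ m then (N : ℝ) / (π * (|(m : ℝ)| - |(lam : ℝ)|)) else 0 := by
  have hπ : 0 < π := Real.pi_pos
  have hm₁ : lam + m ≠ 0 := by
    have h1 := le_abs_self lam; have h2 := neg_abs_le lam; have h3 := lt_abs.1 hm; omega
  have hm₂ : lam - m ≠ 0 := by
    have h1 := le_abs_self lam; have h2 := neg_abs_le lam; have h3 := lt_abs.1 hm; omega
  have h := norm_fourierCoeff_nTooth_le hN lam hg₀ hm₁ hm₂
  refine h.trans ?_
  split_ifs with hd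
  · have hmr : |(lam : ℝ)| < |(m : ℝ)| := by exact_mod_cast hm
    have hd0 : 0 < |(m : ℝ)| - |(lam : ℝ)| := by linarith
    have hfac : |((lam : ℝ)) ^ 2 - (m : ℝ) ^ 2| = (|(m : ℝ)| - |(lam : ℝ)|) * (|(m : ℝ)| + |(lam : ℝ)|) := by
      rw [show ((lam : ℝ)) ^ 2 - (m : ℝ) ^ 2 = -((|(m : ℝ)| - |(lam : ℝ)|) * (|(m : ℝ)| + |(lam : ℝ)|)) by
        rw [← sq_abs (lam : ℝ), ← sq_abs (m : ℝ)]; ring, abs_neg,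
        abs_of_pos (mul_pos hd0 (by linarith [abs_nonneg (lam : ℝ)]))]
    have hs : |Real.sin (π * ((lam : ℝ) + m) / (2 * N))| ≤ 1 := Real.abs_sin_le_one _
    have hpos : 0 ≤ 2 * (N : ℝ) * |(lam : ℝ)| / (π * |((lam : ℝ)) ^ 2 - (m : ℝ) ^ 2|) := by positivity
    calc |Real.sin (π * ((lam : ℝ) + m) / (2 * N))| * (2 * N * |(lam : ℝ)| / (π * |((lam : ℝ)) ^ 2 - (m : ℝ) ^ 2|))
        ≤ 1 * (2 * N * |(lam : ℝ)| / (π * |((lam : ℝ)) ^ 2 - (m : ℝ) ^ 2|)) := mul_le_mul_of_nonneg_right hs hpos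
      _ = 2 * N * |(lam : ℝ)| / (π * ((|(m : ℝ)| - |(lam : ℝ)|) * (|(m : ℝ)| + |(lam : ℝ)|))) := by rw [one_mul, hfac]
      _ ≤ (N : ℝ) / (π * (|(m : ℝ)| - |(lam : ℝ)|)) := by
          have hsum : 0 < |(m : ℝ)| + |(lam : ℝ)| := by linarith [abs_nonneg (lam : ℝ)]
          rw [div_le_div_iff₀ (mul_pos hπ (mul_pos hd0 hsum)) (mul_pos hπ hd0)]
          have h2 : 2 * |(lam : ℝ)| ≤ |(m : ℝ)| + |(lam : ℝ)| := by linarith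
          have h3 : 0 ≤ (N : ℝ) * (π * (|(m : ℝ)| - |(lam : ℝ)|)) := by positivity
          nlinarith
  · exact le_rfl

/-- **Inside the lobes**: for `|m| < |λ|`, `‖ĝ₀(m)‖ ≤ [N∣m]·2N|λ|/(π(λ²−m²))`. [cite: Grafakos2014, Prop. 3.1.2 (5)] -/
theorem norm_fourierCoeff_nTooth_le_inside {N : ℕ} (hN : 0 < N) (lam : ℤ) {g₀ : UnitAddCircle → ℂ}
    (hg₀ : ∀ t : ℝ, g₀ (t : UnitAddCircle) = Complex.exp (-(2 * π * I * lam * ((tri (2 * π * N * t) / (2 * π * N) : ℝ) : ℂ))))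
    {m : ℤ} (hm : |m| < |lam|) :
    ‖fourierCoeff g₀ m‖ ≤ if (N : ℤ) ∣ m then 2 * (N : ℝ) * |(lam : ℝ)| / (π * (((lam : ℝ)) ^ 2 - (m : ℝ) ^ 2)) else 0 := by
  have hπ : 0 < π := Real.pi_pos
  have hm₁ : lam + m ≠ 0 := by
    have h1 := le_abs_self m; have h2 := neg_abs_le m; have h3 := lt_abs.1 hm; omega
  have hm₂ : lam - m ≠ 0 := by
    have h1 := le_abs_self m; have h2 := neg_abs_le m; have h3 := lt_abs.1 hm; omega
  have h := norm_fourierCoeff_nTooth_le hN lam hg₀ hm₁ hm₂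
  refine h.trans ?_
  split_ifs with hd
  · have hmr : |(m : ℝ)| < |(lam : ℝ)| := by exact_mod_cast hm
    have hpos2 : 0 < ((lam : ℝ)) ^ 2 - (m : ℝ) ^ 2 := by nlinarith [abs_nonneg (m : ℝ), sq_abs (lam : ℝ), sq_abs (m : ℝ)]
    rw [abs_of_pos hpos2]
    have hs : |Real.sin (π * ((lam : ℝ) + m) / (2 * N))| ≤ 1 := Real.abs_sin_le_one _
    have hpos : 0 ≤ 2 * (N : ℝ) * |(lam : ℝ)| / (π * (((lam : ℝ)) ^ 2 - (m : ℝ) ^ 2)) := by positivity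
    calc |Real.sin (π * ((lam : ℝ) + m) / (2 * N))| * (2 * N * |(lam : ℝ)| / (π * (((lam : ℝ)) ^ 2 - (m : ℝ) ^ 2)))
        ≤ 1 * (2 * N * |(lam : ℝ)| / (π * (((lam : ℝ)) ^ 2 - (m : ℝ) ^ 2))) := mul_le_mul_of_nonneg_right hs hpos
      _ = 2 * N * |(lam : ℝ)| / (π * (((lam : ℝ)) ^ 2 - (m : ℝ) ^ 2)) := one_mul _
  · exact le_rfl

/-- Off the lobes and off the multiples of `N` the coefficient vanishes. [cite: Grafakos2014, Prop. 3.1.2 (5)] -/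
theorem fourierCoeff_nTooth_eq_zero_of_not_dvd {N : ℕ} (hN : 0 < N) (lam : ℤ) {g₀ : UnitAddCircle → ℂ}
    (hg₀ : ∀ t : ℝ, g₀ (t : UnitAddCircle) = Complex.exp (-(2 * π * I * lam * ((tri (2 * π * N * t) / (2 * π * N) : ℝ) : ℂ))))
    {m : ℤ} (hm : |m| ≠ |lam|) (hd : ¬ (N : ℤ) ∣ m) : fourierCoeff g₀ m = 0 := by
  have hm₁ : lam + m ≠ 0 := fun h => hm (by rw [show m = -lam by omega, abs_neg])
  have hm₂ : lam - m ≠ 0 := fun h => hm (by rw [show m = lam by omega])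
  rw [fourierCoeff_nTooth_exactChirp hN lam hg₀ hm₁ hm₂, if_neg hd]

/-! ## §4 The exact chirp's energy outside / inside the lobes -/

/-- **Energy beyond the lobes**: for `λ = N·L` and `E ≥ 2`,
`Σ'_{|m| ≥ |λ| + N·E} ‖ĝ₀(m)‖² ≤ 2/(π²(E−1))`. [cite: Grafakos2014, Prop. 3.1.2 (5), Prop. 3.2.7 (3)] -/
theorem tsum_outside_sq_norm_nTooth_le {N : ℕ} (hN : 0 < N) {lam L : ℤ} (hL : lam = N * L) {g₀ : UnitAddCircle → ℂ}
    (hg₀ : ∀ t : ℝ, g₀ (t : UnitAddCircle) = Complex.exp (-(2 * π * I * lam * ((tri (2 * π * N * t) / (2 * π * N) : ℝ) : ℂ))))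
    (hg₀c : Continuous g₀) {E : ℕ} (hE : 2 ≤ E) :
    ∑' m : ℤ, (if |lam| + (N : ℤ) * E ≤ |m| then ‖fourierCoeff g₀ m‖ ^ 2 else 0) ≤ 2 / (π ^ 2 * ((E : ℝ) - 1)) := by
  classical
  have hπ : 0 < π := Real.pi_pos
  have hNr : (0 : ℝ) < N := by exact_mod_cast hN
  have hE' : (2 : ℝ) ≤ E := by exact_mod_cast hE
  have hP := hasSum_sq_norm_fourierCoeff_nTooth hg₀ hg₀c
  set F : ℤ → ℝ := fun m => if |lam| + (N : ℤ) * E ≤ |m| then ‖fourierCoeff g₀ m‖ ^ 2 else 0 with hF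
  have hF0 : ∀ m, 0 ≤ F m := fun m => by simp only [hF]; split_ifs <;> positivity
  have hFs : Summable F := Summable.of_nonneg_of_le hF0
    (fun m => by simp only [hF]; split_ifs; exacts [le_rfl, sq_nonneg _]) hP.summable
  -- supported on multiples of `N`
  have hFN : ∀ m : ℤ, ¬ (N : ℤ) ∣ m → F m = 0 := by
    intro m hd
    simp only [hF]
    split_ifs with h
    · have hm : |m| ≠ |lam| := by
        have : (1 : ℤ) ≤ (N : ℤ) * E := by nlinarith [show (1 : ℤ) ≤ N by exact_mod_cast hN, show (2 : ℤ) ≤ E by exact_mod_cast hE]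
        omega
      rw [fourierCoeff_nTooth_eq_zero_of_not_dvd hN lam hg₀ hm hd]; simp
    · rfl
  rw [tsum_eq_tsum_multiples hN hFN]
  -- the reindexed function
  set G : ℤ → ℝ := fun j => F ((N : ℤ) * j) with hG
  have hG0 : ∀ j, 0 ≤ G j := fun j => hF0 _
  have hGs : Summable G := hFs.comp_injective (mul_right_injective₀ (by exact_mod_cast hN.ne' : (N : ℤ) ≠ 0))
  -- pointwise: `G j ≤ [|L|+E ≤ |j|] / (π²(|j|−|L|)²)`
  have hGle : ∀ j : ℤ, G j ≤ if |L| + (E : ℤ) ≤ |j| then 1 / (π ^ 2 * ((|(j : ℝ)| - |(L : ℝ)|) ^ 2)) else 0 := by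
    intro j
    simp only [hG, hF]
    have habs : |(N : ℤ) * j| = (N : ℤ) * |j| := by rw [abs_mul, Nat.abs_cast]
    have hlam : |lam| = (N : ℤ) * |L| := by rw [hL, abs_mul, Nat.abs_cast]
    by_cases h : |L| + (E : ℤ) ≤ |j|
    · have h' : |lam| + (N : ℤ) * E ≤ |(N : ℤ) * j| := by rw [habs, hlam]; nlinarith [show (0 : ℤ) ≤ N by positivity]
      rw [if_pos h', if_pos h]
      have hout : |lam| < |(N : ℤ) * j| := by
        have : (1 : ℤ) ≤ (N : ℤ) * E := by nlinarith [show (1 : ℤ) ≤ N by exact_mod_cast hN, show (2 : ℤ) ≤ E by exact_mod_cast hE]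
        omega
      have hb := norm_fourierCoeff_nTooth_le_outside hN lam hg₀ hout
      rw [if_pos (dvd_mul_right _ _)] at hb
      have hd0 : 0 < |(j : ℝ)| - |(L : ℝ)| := by
        have : |(L : ℝ)| + (E : ℝ) ≤ |(j : ℝ)| := by exact_mod_cast h
        linarith
      have e : |(((N : ℤ) * j : ℤ) : ℝ)| - |(lam : ℝ)| = (N : ℝ) * (|(j : ℝ)| - |(L : ℝ)|) := by
        rw [hL]; push_cast; rw [abs_mul, abs_mul, Nat.abs_cast]; ring
      rw [e] at hb
      have hb' : ‖fourierCoeff g₀ ((N : ℤ) * j)‖ ≤ 1 / (π * (|(j : ℝ)| - |(L : ℝ)|)) := by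
        refine hb.trans (le_of_eq ?_)
        field_simp
      calc ‖fourierCoeff g₀ ((N : ℤ) * j)‖ ^ 2 ≤ (1 / (π * (|(j : ℝ)| - |(L : ℝ)|))) ^ 2 :=
            pow_le_pow_left₀ (norm_nonneg _) hb' 2
        _ = 1 / (π ^ 2 * (|(j : ℝ)| - |(L : ℝ)|) ^ 2) := by rw [div_pow, one_pow, mul_pow]
    · have h' : ¬ |lam| + (N : ℤ) * E ≤ |(N : ℤ) * j| := by
        rw [habs, hlam]; intro h''; apply h
        have hN1 : (0 : ℤ) < N := by exact_mod_cast hN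
        nlinarith
      rw [if_neg h', if_neg h]
  -- sum the majorant over the two rays `j = ±(|L| + E + e)`
  set H : ℤ → ℝ := fun j => if |L| + (E : ℤ) ≤ |j| then 1 / (π ^ 2 * ((|(j : ℝ)| - |(L : ℝ)|) ^ 2)) else 0 with hH
  have hH0 : ∀ j, 0 ≤ H j := fun j => by simp only [hH]; split_ifs <;> positivity
  set B : ℕ := L.natAbs + E with hB
  have hBz : (B : ℤ) = |L| + E := by rw [hB]; push_cast; ring
  have hBr : ((B : ℕ) : ℝ) = |(L : ℝ)| + E := by
    have h := congrArg (fun z : ℤ => (z : ℝ)) hBz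
    push_cast at h
    exact h
  have hray : ∀ e : ℕ, H ((B : ℤ) + e) = 1 / π ^ 2 * (1 / (((E : ℝ) + e) ^ 2)) := by
    intro e
    simp only [hH]
    have hpos : (0 : ℤ) ≤ (B : ℤ) + e := by positivity
    rw [if_pos (by rw [abs_of_nonneg hpos, hBz]; omega)]
    have e1 : |(((B : ℤ) + e : ℤ) : ℝ)| - |(L : ℝ)| = (E : ℝ) + e := by
      push_cast
      rw [abs_of_nonneg (by positivity), hBr]
      ring
    rw [e1]
    field_simp
  have hray' : ∀ e : ℕ, H (-((B : ℤ) + e)) = 1 / π ^ 2 * (1 / (((E : ℝ) + e) ^ 2)) := by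
    intro e
    have hs : H (-((B : ℤ) + e)) = H ((B : ℤ) + e) := by simp only [hH, abs_neg, Int.cast_neg]
    rw [hs, hray e]
  have hHs1 : Summable fun e : ℕ => H ((B : ℤ) + e) := by
    simp_rw [hray]
    exact ((summable_nat_add_iff E).2 (Real.summable_one_div_nat_pow.2 one_lt_two) |>.congr fun e => by
      push_cast; ring_nf).mul_left _
  have hHs2 : Summable fun e : ℕ => H (-((B : ℤ) + e)) := by simp_rw [hray']; simp_rw [← hray]; exact hHs1
  -- `H` is summable on `ℤ`: bounded by the rays
  have hHs : Summable H := by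
    have hinjp : Function.Injective (fun e : ℕ => (B : ℤ) + e) := fun a b h => by simpa using h
    have hinjm : Function.Injective (fun e : ℕ => -((B : ℤ) + e)) := fun a b h => by simpa using h
    set Hp : ℤ → ℝ := fun m => if (B : ℤ) ≤ m then H m else 0 with hHp
    set Hm : ℤ → ℝ := fun m => if m ≤ -(B : ℤ) then H m else 0 with hHm
    have hsp : Function.support Hp ⊆ Set.range (fun e : ℕ => (B : ℤ) + e) := by
      intro m hm; rw [Function.mem_support] at hm
      have h : (B : ℤ) ≤ m := by by_contra h; exact hm (by simp [hHp, h])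
      exact ⟨(m - B).toNat, by simp only; omega⟩
    have hsm : Function.support Hm ⊆ Set.range (fun e : ℕ => -((B : ℤ) + e)) := by
      intro m hm; rw [Function.mem_support] at hm
      have h : m ≤ -(B : ℤ) := by by_contra h; exact hm (by simp [hHm, h])
      exact ⟨(-m - B).toNat, by simp only; omega⟩
    have hsp' : ∀ m ∉ Set.range (fun e : ℕ => (B : ℤ) + e), Hp m = 0 := fun m hm =>
      Classical.not_not.1 fun h => hm (hsp (Function.mem_support.2 h))
    have hsm' : ∀ m ∉ Set.range (fun e : ℕ => -((B : ℤ) + e)), Hm m = 0 := fun m hm =>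
      Classical.not_not.1 fun h => hm (hsm (Function.mem_support.2 h))
    have hHp_s : Summable Hp := by
      rw [← hinjp.summable_iff hsp']
      refine hHs1.congr fun e => ?_
      simp only [Function.comp_apply, hHp]; rw [if_pos (by omega)]
    have hHm_s : Summable Hm := by
      rw [← hinjm.summable_iff hsm']
      refine hHs2.congr fun e => ?_
      simp only [Function.comp_apply, hHm]; rw [if_pos (by omega)]
    refine (hHp_s.add hHm_s).of_nonneg_of_le hH0 fun m => ?_
    simp only [hHp, hHm]
    by_cases h1 : (B : ℤ) ≤ m
    · rw [if_pos h1]; split_ifs <;> linarith [hH0 m]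
    · rw [if_neg h1]
      by_cases h2 : m ≤ -(B : ℤ)
      · rw [if_pos h2]; linarith
      · rw [if_neg h2]
        have : H m = 0 := by simp only [hH]; rw [if_neg (by rw [← hBz, not_le, abs_lt]; omega)]
        linarith
  have h1 : ∑' j, G j ≤ ∑' j, H j := Summable.tsum_le_tsum hGle hGs hHs
  have h2 := tsum_le_tsum_rays hH0 hHs B (fun m hm => by
    simp only [hH]; rw [if_neg (by rw [← hBz]; omega)])
  have h3 : ∑' e : ℕ, H ((B : ℤ) + e) ≤ 1 / π ^ 2 * (1 / ((E : ℝ) - 1)) := by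
    simp_rw [hray]
    rw [tsum_mul_left]
    exact mul_le_mul_of_nonneg_left (tsum_inv_sq_shift_le hE) (by positivity)
  have h4 : ∑' e : ℕ, H (-((B : ℤ) + e)) ≤ 1 / π ^ 2 * (1 / ((E : ℝ) - 1)) := by
    simp_rw [hray']
    rw [tsum_mul_left]
    exact mul_le_mul_of_nonneg_left (tsum_inv_sq_shift_le hE) (by positivity)
  have e5 : 2 / (π ^ 2 * ((E : ℝ) - 1)) = 1 / π ^ 2 * (1 / ((E : ℝ) - 1)) + 1 / π ^ 2 * (1 / ((E : ℝ) - 1)) := by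
    field_simp; ring
  linarith

/-- **Energy strictly between the lobes, beyond distance `D`**: for `λ = N·L`, `D = N·E ≤ |λ|` with `E ≥ 1`,
`Σ_{|m| ≤ |λ|−D} ‖ĝ₀(m)‖² ≤ (2(|L|−E)+1)·(2N|λ|/(π·D·(2|λ|−D)))²`. [cite: Grafakos2014, Prop. 3.1.2 (5)] -/
theorem sum_inside_sq_norm_nTooth_le {N : ℕ} (hN : 0 < N) {lam L : ℤ} (hL : lam = N * L) {g₀ : UnitAddCircle → ℂ}
    (hg₀ : ∀ t : ℝ, g₀ (t : UnitAddCircle) = Complex.exp (-(2 * π * I * lam * ((tri (2 * π * N * t) / (2 * π * N) : ℝ) : ℂ))))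
    {E : ℕ} (hE : 1 ≤ E) (hEL : (E : ℤ) ≤ |L|) :
    ∑ m ∈ Finset.Icc (-(|lam| - (N : ℤ) * E)) (|lam| - (N : ℤ) * E), ‖fourierCoeff g₀ m‖ ^ 2 ≤
      (2 * (|(L : ℝ)| - E) + 1) * (2 * N * |(lam : ℝ)| / (π * ((N : ℝ) * E * (2 * |(lam : ℝ)| - (N : ℝ) * E)))) ^ 2 := by
  classical
  have hπ : 0 < π := Real.pi_pos
  have hNz : (0 : ℤ) < N := by exact_mod_cast hN
  have hNr : (0 : ℝ) < N := by exact_mod_cast hN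
  have hlam : |lam| = (N : ℤ) * |L| := by rw [hL, abs_mul, Nat.abs_cast]
  set M : ℤ := |lam| - (N : ℤ) * E with hM
  have hM0 : 0 ≤ M := by rw [hM, hlam]; nlinarith
  have hMN : M = (N : ℤ) * (|L| - E) := by rw [hM, hlam]; ring
  -- the nonzero terms sit on the multiples of `N` in `[-M, M]`
  set S : Finset ℤ := (Finset.Icc (-(|L| - E)) (|L| - E)).image (fun j => (N : ℤ) * j) with hS
  have hzero : ∀ m ∈ Finset.Icc (-M) M, m ∉ S → ‖fourierCoeff g₀ m‖ ^ 2 = 0 := by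
    intro m hm hmS
    rw [Finset.mem_Icc] at hm
    have hd : ¬ (N : ℤ) ∣ m := by
      rintro ⟨j, rfl⟩
      apply hmS
      rw [hS, Finset.mem_image]
      refine ⟨j, Finset.mem_Icc.2 ⟨?_, ?_⟩, rfl⟩ <;> nlinarith
    have hm' : |m| ≠ |lam| := by
      have : (1 : ℤ) ≤ (N : ℤ) * E := by nlinarith [show (1 : ℤ) ≤ E by exact_mod_cast hE]
      have : |m| ≤ M := abs_le.2 hm
      omega
    simp [fourierCoeff_nTooth_eq_zero_of_not_dvd hN lam hg₀ hm' hd]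
  have hSsub : S ⊆ Finset.Icc (-M) M := by
    intro m hm
    rw [hS, Finset.mem_image] at hm
    obtain ⟨j, hj, rfl⟩ := hm
    rw [Finset.mem_Icc] at hj ⊢
    rw [hMN]; constructor <;> nlinarith
  rw [← Finset.sum_subset hSsub (fun m hm hmS => hzero m hm hmS)]
  -- termwise bound on `S`
  set c : ℝ := 2 * N * |(lam : ℝ)| / (π * ((N : ℝ) * E * (2 * |(lam : ℝ)| - (N : ℝ) * E))) with hc
  have hE1 : (1 : ℝ) ≤ E := by exact_mod_cast hE
  have hD : (0 : ℝ) < (N : ℝ) * E := mul_pos hNr (by linarith)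
  have hlamr : |(lam : ℝ)| = (N : ℝ) * |(L : ℝ)| := by rw [hL]; push_cast; rw [abs_mul, Nat.abs_cast]
  have hEL' : (E : ℝ) ≤ |(L : ℝ)| := by
    have : ((E : ℤ) : ℝ) ≤ ((|L| : ℤ) : ℝ) := by exact_mod_cast hEL
    push_cast at this; exact this
  have h2lam : (N : ℝ) * E < 2 * |(lam : ℝ)| := by rw [hlamr]; nlinarith
  have hterm : ∀ m ∈ S, ‖fourierCoeff g₀ m‖ ^ 2 ≤ c ^ 2 := by
    intro m hm
    have hmM := hSsub hm
    rw [Finset.mem_Icc, ← abs_le] at hmM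
    have hin : |m| < |lam| := by
      have : (1 : ℤ) ≤ (N : ℤ) * E := by nlinarith [show (1 : ℤ) ≤ E by exact_mod_cast hE]
      omega
    have hb := norm_fourierCoeff_nTooth_le_inside hN lam hg₀ hin
    have hmr : |(m : ℝ)| ≤ |(lam : ℝ)| - (N : ℝ) * E := by
      have : ((|m| : ℤ) : ℝ) ≤ ((|lam| - (N : ℤ) * E : ℤ) : ℝ) := by exact_mod_cast hmM
      push_cast at this; exact this
    have hden : (N : ℝ) * E * (2 * |(lam : ℝ)| - (N : ℝ) * E) ≤ ((lam : ℝ)) ^ 2 - (m : ℝ) ^ 2 := by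
      rw [← sq_abs (lam : ℝ), ← sq_abs (m : ℝ)]
      nlinarith [abs_nonneg (m : ℝ)]
    have hdenpos : 0 < (N : ℝ) * E * (2 * |(lam : ℝ)| - (N : ℝ) * E) := mul_pos hD (by linarith)
    have hb' : ‖fourierCoeff g₀ m‖ ≤ c := by
      refine hb.trans ?_
      split_ifs
      · rw [hc]
        exact div_le_div_of_nonneg_left (by positivity) (mul_pos hπ hdenpos) (mul_le_mul_of_nonneg_left hden hπ.le)
      · rw [hc]; positivity
    exact pow_le_pow_left₀ (norm_nonneg _) hb' 2
  have hcard : (S.card : ℝ) ≤ 2 * (|(L : ℝ)| - E) + 1 := by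
    rw [hS, Finset.card_image_of_injective _ (mul_right_injective₀ hNz.ne'), Int.card_Icc]
    have h0 : (0 : ℤ) ≤ 2 * (|L| - E) + 1 := by linarith
    rw [show |L| - E + 1 - -(|L| - E) = 2 * (|L| - E) + 1 by ring, ← Int.cast_natCast (R := ℝ),
      Int.toNat_of_nonneg h0]
    push_cast
    exact le_rfl
  calc ∑ m ∈ S, ‖fourierCoeff g₀ m‖ ^ 2 ≤ ∑ m ∈ S, c ^ 2 := Finset.sum_le_sum hterm
    _ = S.card * c ^ 2 := by rw [Finset.sum_const, nsmul_eq_mul]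
    _ ≤ (2 * (|(L : ℝ)| - E) + 1) * c ^ 2 := mul_le_mul_of_nonneg_right hcard (sq_nonneg _)

end Summit.AnomalousDissipation.AnomalousDissipation.Theorems.SawtoothPulseCascade.K1Window
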